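import Mathlib
import Summits.NavierStokesRegularity.NavierStokesRegularity.Theorems.TaoLadderRungTwoFlatCoreHopFlat
import HarnessLib

/-!
# CORE ROW 56 (part 2 of 3) — theory-1 g44's cure of TRAP #14 (the core row gain in `HopTube.core_hop_flat_closed`): L-56c, the phase landing in site form with the ANCHOR clause (second order at the anchor site)
  (helper for the K_A♭ parent item stmt-NavierStokesRegularity-22987 `FlatGapCertificatesV2`, children 1A/2A of route
  TaoLadderRungTwoFlat; cell harvest/h2-tao-ladder, theory-1 g44, memo numT56/CORE-ROW-56 / LADDER §56)

PROVENANCE (p1 g23): theory-1 g44's image of record numT56/CoreRow56.lean sha16 0faf4d271a46ab3c (747 l., farm `lean check`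
rc 0 · 0 sorry · 0 warnings · axioms propext/Classical.choice/Quot.sound), landed with declarations BYTE-IDENTICAL in THREE
modules (400-line lint): part 1 `…CoreRowGauge` (L-56a: `QuadPolar.gauge_abs_accel_le_of_sup`, `gauge_abs_taylor_le_of_sup`,
`MirrorPulse.gauge_abs_quadTermOn_sub_time_le_of_sup`, `landing_at_section_time_gauge`), part 2 `…CoreRowAnchor` (L-56c:
`MirrorPulse.anchored_landing_site`, `core_phase_landing_flat_anchored`), part 3 `…CoreRowSharp` (L-56b:
`HopTube.isWindowRegular_geomGauge_shift`, `geomGauge_pred_le_headGauge`, `core_landing_at_section_time_sharp`,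
`core_hop_flat_closed_sharp`). This is part 2. The image's module docstring follows verbatim.

# numT56 (theory-1 g44, cell harvest/h2-tao-ladder): the CORE ROW of the flat tube WITHOUT the two gain artefacts
  (trap-candidate #14 "core row gain" in `HopTube.core_hop_flat_closed`; cures L-56a/b/c; helper material for the K_A♭
  parent item stmt-NavierStokesRegularity-22987 `FlatGapCertificatesV2`, children 1A/2A of route TaoLadderRungTwoFlat)

THE TRAP. The landed composition `HopTube.core_hop_flat_closed` (p1 g22) is a true theorem whose budget cannot be met
along a ladder with a non-growing tube: its `CoreClause (n+1)` costs `a·δ(n+1) ≥ η̄₁·(1 + M_ω/(ω₀A_*)) ≥ 2·η̄₁` with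
`η̄₁ ≥ D ≥ C_conv·ρ·B`, `C_conv = max(g, b^{K+1}) ≥ 4`, so the per-hop factor on the core datum is `≥ 2·C_conv·ρ ≥ 8ρ`
(`ρ ≈ 0.61` certified-scale float, E-T46-hop): two bookkeeping losses, each alone fatal —
(L1) GAUGE ROUND TRIP: the contraction-gauge landing (`core_phase_landing_flat`, leading term `ρB`) is converted to a
  UNIFORM head-gauge datum (`× C_conv`) only because `MirrorPulse.landing_at_section_time` is typed in the head gauge
  (window-ADMISSIBLE), and converted back in `core_landing_at_section_time` (losing nothing more);
(L2) ANCHOR READ-OFF: the anchor-scale mismatch is fed with the UNIFORM landing error `η̄₁/ω₀`, although at the anchor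
  site the corrected deviation vanishes EXACTLY (`anchorCoeff_spec`): the anchor datum is second order.

THE CURES (this file, kernel-checked against the tree):
* L-56a `QuadPolar.gauge_abs_accel_le_of_sup`, `gauge_abs_taylor_le_of_sup`, `MirrorPulse.gauge_abs_quadTermOn_sub_time_le_of_sup`,
  `MirrorPulse.landing_at_section_time_gauge` — the section-time step in ANY window-REGULAR gauge (mixed sup/gauge
  bounds replace admissibility), in SITE FORM (the leading term is the site's own landing datum); applied in the
  shifted contraction gauge `ω♯_m = geomGauge(m−1)` (`Λ = max(g,b)`) there is no conversion constant at all;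
* L-56c `MirrorPulse.anchored_landing_site`, `core_phase_landing_flat_anchored` — the phase landing with the extra
  ANCHOR clause `ω₀|X_{i₀,1}(τ) − κΦ_{i₀,1}(τ+h)| ≤ 12C_aB²‖T♭‖₁²g²M_w³` (pure second order);
* L-56b `HopTube.core_landing_at_section_time_sharp`, `HopTube.core_hop_flat_closed_sharp` — the re-composed core hop:
  budget `(E + S) + ((E_a + S)/ω₀/A_*)·M_ω ≤ a·δ(n+1)` with `E ≥ ρB + (1+q)Rem + 12C_aB²G` entering ONCE, `E_a = 12C_aB²G`
  and `S = O(C_aB² + C_aB·E)`: the coefficient of `B` is `ρ` — the certified contraction rate, undiluted.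

HONEST FRAMING: conditional estimates about MODEL-lattice solutions (Tao 2016 §4 vocabulary on `S♭`, `mirrorTable ε ε`,
m = 2); the anchored contraction (S2) and all bounds are HYPOTHESES; desk floats quoted above are UNSEALED; nothing
certified; no item closed; nothing about the Navier–Stokes equations.
-/

noncomputable section

-- the sub-problem namespace repeats the summit name by design (D-0017)
set_option linter.dupNamespace false

namespace Summit.NavierStokesRegularity.NavierStokesRegularity.Theorems

open Set Filter Literature.Analysis.FluidPDE Literature.Analysis.FluidPDE.TaoCascade QuadPolar
open scoped Topology

namespace MirrorPulse

/-! ## L-56c: the phase landing in SITE FORM and the ANCHOR clause (second order at the anchor site) -/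

/-- **Re-normalised landing of the anchored hop estimate, SITE FORM.** As `anchored_landing`, but the leading term is
the site's own corrected deviation `ω_{i,k}|η_{i,k+1}(τ) − c₁Q(Φ)_{i,k+1}(τ) − ĉ₂Φ_{i,k+1}(τ)|` instead of the uniform
`E`: `ω_{i,k}|X_{i,k+1}(τ) − κΦ_{i,k+1}(τ+h)| ≤ ω_{i,k}|η − c₁Q(Φ) − ĉ₂Φ|_{i,k+1}(τ) + 12C_aB²‖T♭‖₁²g²M_w³`
(`κ = 1 + ĉ₂`, `h = c₁/κ`). At the anchor site the first term is `0` (`anchorCoeff_spec`).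
[cite: Tao2016AveragedNS, §4 (4.8), §6.3–6.4 (statement shape); cell harvest/h2-tao-ladder numT56 L-56c (cf. `anchored_landing`)] -/
theorem anchored_landing_site {ε τ : ℝ} {Φ X η : Fin 2 → ℤ → ℝ → ℝ} {g b Mw CaB c₁ c₂ : ℝ}
    (hΦ : IsGlobalSol ε Φ) (hg : 1 ≤ g) (hb : 1 ≤ b) (hMw : 0 ≤ Mw)
    (hΦg : ∀ j k, ∀ t ∈ Icc (τ - 1) (τ + 1), headGauge g j k * |Φ j k t| ≤ Mw)
    (hc₁ : |c₁| ≤ CaB) (hc₂ : |c₂| ≤ CaB) (hCaB : CaB ≤ 1 / 2)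
    (i : Fin 2) (k : ℤ) (hηX : η i (k + 1) τ = X i (k + 1) τ - Φ i (k + 1) τ) :
    geomGauge g b i k * |X i (k + 1) τ - (1 + c₂) * Φ i (k + 1) (τ + c₁ / (1 + c₂))| ≤
      geomGauge g b i k *
          |η i (k + 1) τ - c₁ * quadTermOn shiftSetFlat 0 (mirrorTable ε ε) Φ i (k + 1) τ - c₂ * Φ i (k + 1) τ|
        + 12 * CaB ^ 2 * ((tableAbsSum shiftSetFlat (mirrorTable ε ε)) ^ 2 * g ^ 2 * Mw ^ 3) := by
  set κ : ℝ := 1 + c₂ with hκ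
  have hc₂' : |c₂| ≤ 1 / 2 := hc₂.trans hCaB
  have hκlo : 1 / 2 ≤ κ := by rw [hκ]; linarith [(abs_le.mp hc₂').1]
  have hκhi : κ ≤ 3 / 2 := by rw [hκ]; linarith [(abs_le.mp hc₂').2]
  have hκpos : 0 < κ := by linarith
  set h : ℝ := c₁ / κ with hh
  have hCaB0 : 0 ≤ CaB := (abs_nonneg _).trans hc₁
  have hhabs : |h| ≤ 2 * CaB := by
    rw [hh, abs_div, abs_of_pos hκpos, div_le_iff₀ hκpos]
    nlinarith [hc₁, abs_nonneg c₁]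
  have hh1 : |h| ≤ 1 := hhabs.trans (by linarith)
  -- gauges
  have hwpos : ∀ j n, 0 < headGauge g j n := fun j n => headGauge_pos (by linarith) j n
  have hA : IsWindowAdmissible (headGauge g) g := isWindowAdmissible_headGauge hg
  have hωw : geomGauge g b i k ≤ headGauge g i (k + 1) :=
    (geomGauge_le_succ hg hb i k).trans (geomGauge_le_headGauge (by linarith) hb i (k + 1))
  have hω0 : 0 ≤ geomGauge g b i k := (geomGauge_pos (by linarith) (by linarith) i k).le
  -- Taylor part on the pulse, head gauge at the read-out site, then dominated in ω
  set G : ℝ := (tableAbsSum shiftSetFlat (mirrorTable ε ε)) ^ 2 * g ^ 2 * Mw ^ 3 with hG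
  have hG0 : 0 ≤ G := by rw [hG]; positivity
  have htay := gauge_abs_taylor_le isNearestNeighbourSet_shiftSetFlat (mirrorTable ε ε) hwpos hA hMw hΦ hΦg hh1
    i (k + 1)
  have h2 : geomGauge g b i k * |κ * (Φ i (k + 1) (τ + h) - Φ i (k + 1) τ
      - h * quadTermOn shiftSetFlat 0 (mirrorTable ε ε) Φ i (k + 1) τ)| ≤ 12 * CaB ^ 2 * G := by
    rw [abs_mul, abs_of_pos hκpos]
    have hh2 : h ^ 2 ≤ (2 * CaB) ^ 2 := by
      rw [← sq_abs]; exact pow_le_pow_left₀ (abs_nonneg _) hhabs 2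
    calc geomGauge g b i k * (κ * |Φ i (k + 1) (τ + h) - Φ i (k + 1) τ
            - h * quadTermOn shiftSetFlat 0 (mirrorTable ε ε) Φ i (k + 1) τ|)
        ≤ headGauge g i (k + 1) * (κ * |Φ i (k + 1) (τ + h) - Φ i (k + 1) τ
            - h * quadTermOn shiftSetFlat 0 (mirrorTable ε ε) Φ i (k + 1) τ|) :=
          mul_le_mul_of_nonneg_right hωw (by positivity)
      _ = κ * (headGauge g i (k + 1) * |Φ i (k + 1) (τ + h) - Φ i (k + 1) τ
            - h * quadTermOn shiftSetFlat 0 (mirrorTable ε ε) Φ i (k + 1) τ|) := by ring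
      _ ≤ κ * (2 * G * h ^ 2) := by
          refine mul_le_mul_of_nonneg_left ?_ hκpos.le
          calc _ ≤ 2 * (tableAbsSum shiftSetFlat (mirrorTable ε ε)) ^ 2 * g ^ 2 * Mw ^ 3 * h ^ 2 := htay
            _ = 2 * G * h ^ 2 := by rw [hG]; ring
      _ ≤ 3 / 2 * (2 * G * (2 * CaB) ^ 2) := by
          have h0 : 0 ≤ 2 * G * h ^ 2 := by positivity
          have h3 : 2 * G * h ^ 2 ≤ 2 * G * (2 * CaB) ^ 2 := mul_le_mul_of_nonneg_left hh2 (by positivity)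
          calc κ * (2 * G * h ^ 2) ≤ 3 / 2 * (2 * G * h ^ 2) := mul_le_mul_of_nonneg_right hκhi h0
            _ ≤ 3 / 2 * (2 * G * (2 * CaB) ^ 2) := mul_le_mul_of_nonneg_left h3 (by norm_num)
      _ = 12 * CaB ^ 2 * G := by ring
  -- algebra: X − κΦ(τ+h) = [η − c₁Φ̇ − c₂Φ] − κ[Φ(τ+h) − Φ(τ) − hΦ̇(τ)]
  have hκh : κ * h = c₁ := by rw [hh]; field_simp
  have e : X i (k + 1) τ - κ * Φ i (k + 1) (τ + h) =
      (η i (k + 1) τ - c₁ * quadTermOn shiftSetFlat 0 (mirrorTable ε ε) Φ i (k + 1) τ - c₂ * Φ i (k + 1) τ) -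
        κ * (Φ i (k + 1) (τ + h) - Φ i (k + 1) τ - h * quadTermOn shiftSetFlat 0 (mirrorTable ε ε) Φ i (k + 1) τ) := by
    rw [hηX]
    linear_combination (-(Φ i (k + 1) τ)) * hκ + (-(quadTermOn shiftSetFlat 0 (mirrorTable ε ε) Φ i (k + 1) τ)) * hκh
  rw [e]
  calc geomGauge g b i k * |(η i (k + 1) τ - c₁ * quadTermOn shiftSetFlat 0 (mirrorTable ε ε) Φ i (k + 1) τ
            - c₂ * Φ i (k + 1) τ)
          - κ * (Φ i (k + 1) (τ + h) - Φ i (k + 1) τ - h * quadTermOn shiftSetFlat 0 (mirrorTable ε ε) Φ i (k + 1) τ)|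
      ≤ geomGauge g b i k * (|η i (k + 1) τ - c₁ * quadTermOn shiftSetFlat 0 (mirrorTable ε ε) Φ i (k + 1) τ
            - c₂ * Φ i (k + 1) τ|
          + |κ * (Φ i (k + 1) (τ + h) - Φ i (k + 1) τ - h * quadTermOn shiftSetFlat 0 (mirrorTable ε ε) Φ i (k + 1) τ)|) :=
        mul_le_mul_of_nonneg_left (abs_sub _ _) hω0
    _ ≤ _ := by rw [mul_add]; exact add_le_add le_rfl h2

/-- **THE CORE PHASE LANDING (flat, scale 1) WITH THE ANCHOR CLAUSE (cure L-56c).** Exactly `core_phase_landing_flat`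
plus the extra conclusion `ω₀·|X_{i₀,1}(τ) − κΦ_{i₀,1}(τ+h)| ≤ 12C_aB²‖T♭‖₁²g²M_w³` (`ω₀ = geomGauge g b i₀ 0`): at the
anchor site the corrected deviation vanishes (`anchorCoeff_spec`), so only the Taylor term survives — the anchor-scale
read-off of the next section state is SECOND ORDER, not the uniform landing error.
[cite: Tao2016AveragedNS, §4 (4.8), §6.3–6.4 (statement shape of the checkpoint step); cell harvest/h2-tao-ladder numT56 L-56c (cf. `core_phase_landing_flat`)] -/
theorem core_phase_landing_flat_anchored {ε τ : ℝ} {Φ X : Fin 2 → ℤ → ℝ → ℝ}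
    {g b ρ C M Mw B B' q ηhat qbar rbar Rτ Qa φa CaB : ℝ}
    {e : ℤ} {i₀ : Fin 2} (hΦ : IsGlobalSol ε Φ) (hX : IsGlobalSol ε X) (hε : 0 ≤ ε) (hτ : 0 ≤ τ) (he : e + 1 ≤ 0)
    (hΦb : ∀ i n t, |Φ i n t| ≤ M) (hXb : ∀ i n t, |X i n t| ≤ M) (hg : 1 ≤ g) (hb : 1 ≤ b)
    (hS2 : AnchoredHopContraction ε τ Φ (geomGauge g b) i₀ ρ C) (hq : 0 ≤ q)
    (hprof : ∀ (i : Fin 2) (k : ℤ), ¬(i = i₀ ∧ k = 0) →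
      geomGauge g b i k * |Φ i (k + 1) τ| ≤ q * (geomGauge g b i₀ 0 * |Φ i₀ 1 τ|))
    (hMw : 0 ≤ Mw) (hΦg : ∀ j k, ∀ t ∈ Icc (τ - 1) (τ + 1), headGauge g j k * |Φ j k t| ≤ Mw)
    (hB : ∀ i k, geomGauge g b i k * |truncFam e (X - Φ) i k 0| ≤ B)
    (hB' : ∀ i k, headGauge g i k * |truncFam e (X - Φ) i k 0| ≤ B')
    (hηhat : 0 ≤ ηhat) (hVe : ∀ t ∈ Icc 0 τ, |Φ 1 e t| ≤ ηhat) (hAe : ∀ t ∈ Icc 0 τ, |Φ 0 (e + 1) t| ≤ ηhat)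
    (hqbar : 0 ≤ qbar) (hqh : ∀ t ∈ Icc 0 τ, |(X - Φ) 1 e t| ≤ qbar)
    (hrbar : 0 ≤ rbar) (hrh : ∀ t ∈ Icc 0 τ, |(X - Φ) 0 (e + 1) t| ≤ rbar)
    (hRτ : |(X - Φ) i₀ 1 τ| ≤ Rτ) (hQa : |quadTermOn shiftSetFlat 0 (mirrorTable ε ε) Φ i₀ 1 τ| ≤ Qa)
    (hφa : 0 < φa) (hφale : φa ≤ |Φ i₀ 1 τ|)
    (hCaB1 : C * B ≤ CaB) (hCaB2 : (Rτ + C * B * Qa) / φa ≤ CaB) (hCaB : CaB ≤ 1 / 2) :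
    ∃ κ h : ℝ, |κ - 1| ≤ CaB ∧ |h| ≤ 2 * CaB ∧ 0 ≤ κ ∧
      geomGauge g b i₀ 0 * |X i₀ 1 τ - κ * Φ i₀ 1 (τ + h)|
          ≤ 12 * CaB ^ 2 * ((tableAbsSum shiftSetFlat (mirrorTable ε ε)) ^ 2 * g ^ 2 * Mw ^ 3) ∧
      ∀ (i : Fin 2) (k : ℤ), e ≤ k →
        geomGauge g b i k * |X i (k + 1) τ - κ * Φ i (k + 1) (τ + h)|
          ≤ (ρ * B + (1 + q) * ((tableAbsSum shiftSetFlat (mirrorTable ε ε) * g *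
              ((B' + (qbar * (2 * ηhat + qbar + ε * (ηhat + rbar)) + rbar * (ηhat + ε * (2 * ηhat + rbar))) * τ)
                * Real.exp (2 * tableAbsSum shiftSetFlat (mirrorTable ε ε) * M * g * τ)) ^ 2
              + (geomGauge g b 0 (e + 1) * (qbar * (2 * ηhat + qbar + ε * (ηhat + rbar)))
                + geomGauge g b 1 e * (rbar * (ηhat + ε * (2 * ηhat + rbar))))) * τ *
              Real.exp (2 * tableAbsSum shiftSetFlat (mirrorTable ε ε) * M * max g b * τ)))
            + 12 * CaB ^ 2 * ((tableAbsSum shiftSetFlat (mirrorTable ε ε)) ^ 2 * g ^ 2 * Mw ^ 3) := by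
  obtain ⟨hωpos, _, _, hC0, hΦa, _⟩ := id hS2
  have hg0 : 0 ≤ g := by linarith
  -- the interface forcing from the amplitudes, in both gauges
  have hc0 : ∀ n : ℤ, clock 0 n = 1 := fun n => by unfold clock; simp
  have hF0 : 0 ≤ qbar * (2 * ηhat + qbar + ε * (ηhat + rbar)) + rbar * (ηhat + ε * (2 * ηhat + rbar)) := by
    positivity
  have hFω0 : 0 ≤ geomGauge g b 0 (e + 1) * (qbar * (2 * ηhat + qbar + ε * (ηhat + rbar)))
      + geomGauge g b 1 e * (rbar * (ηhat + ε * (2 * ηhat + rbar))) := by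
    have h1 := (hωpos 0 (e + 1)).le
    have h2 := (hωpos 1 e).le
    positivity
  -- pointwise bounds of the two forcing components
  have hf0 : ∀ t ∈ Icc 0 τ, |interfaceForcing ε 0 e Φ (X - Φ) 0 (e + 1) t|
      ≤ qbar * (2 * ηhat + qbar + ε * (ηhat + rbar)) := by
    intro t ht
    have h := abs_interfaceForcing_carrier_le hε (by norm_num : (-1 : ℝ) ≤ 0) e Φ (X - Φ) t
    rw [hc0, one_mul] at h
    refine h.trans ?_
    have hin : 2 * |Φ 1 e t| + |(X - Φ) 1 e t| + ε * (|Φ 0 (e + 1) t| + |(X - Φ) 0 (e + 1) t|)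
        ≤ 2 * ηhat + qbar + ε * (ηhat + rbar) := by
      have := mul_le_mul_of_nonneg_left (add_le_add (hAe t ht) (hrh t ht)) hε
      linarith [hVe t ht, hqh t ht]
    exact mul_le_mul (hqh t ht) hin (by positivity) hqbar
  have hf1 : ∀ t ∈ Icc 0 τ, |interfaceForcing ε 0 e Φ (X - Φ) 1 e t| ≤ rbar * (ηhat + ε * (2 * ηhat + rbar)) := by
    intro t ht
    have h := abs_interfaceForcing_bond_le hε (by norm_num : (-1 : ℝ) ≤ 0) e Φ (X - Φ) t
    rw [hc0, one_mul] at h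
    refine h.trans ?_
    have hin : |Φ 1 e t| + ε * (2 * |Φ 0 (e + 1) t| + |(X - Φ) 0 (e + 1) t|) ≤ ηhat + ε * (2 * ηhat + rbar) := by
      have h3 : 2 * |Φ 0 (e + 1) t| + |(X - Φ) 0 (e + 1) t| ≤ 2 * ηhat + rbar := by linarith [hAe t ht, hrh t ht]
      have := mul_le_mul_of_nonneg_left h3 hε
      linarith [hVe t ht]
    exact mul_le_mul (hrh t ht) hin (by positivity) hrbar
  have hfb : ∀ j k, ∀ t ∈ Icc 0 τ, headGauge g j k * |interfaceForcing ε 0 e Φ (X - Φ) j k t|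
      ≤ qbar * (2 * ηhat + qbar + ε * (ηhat + rbar)) + rbar * (ηhat + ε * (2 * ηhat + rbar)) := by
    intro j k t ht
    by_cases h0 : j = 0 ∧ k = e + 1
    · obtain ⟨rfl, rfl⟩ := h0
      rw [headGauge_of_nonpos g 0 he, one_mul]
      exact (hf0 t ht).trans (le_add_of_nonneg_right (by positivity))
    by_cases h1 : j = 1 ∧ k = e
    · obtain ⟨rfl, rfl⟩ := h1
      rw [headGauge_of_nonpos g 1 (by omega), one_mul]
      exact (hf1 t ht).trans (le_add_of_nonneg_left (by positivity))
    · rw [interfaceForcing_eq_zero ε 0 Φ (X - Φ) h0 h1 t, abs_zero, mul_zero]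
      exact hF0
  have hfω : ∀ j k, ∀ t ∈ Icc 0 τ, geomGauge g b j k * |interfaceForcing ε 0 e Φ (X - Φ) j k t|
      ≤ geomGauge g b 0 (e + 1) * (qbar * (2 * ηhat + qbar + ε * (ηhat + rbar)))
        + geomGauge g b 1 e * (rbar * (ηhat + ε * (2 * ηhat + rbar))) := by
    intro j k t ht
    by_cases h0 : j = 0 ∧ k = e + 1
    · obtain ⟨rfl, rfl⟩ := h0
      exact (mul_le_mul_of_nonneg_left (hf0 t ht) (hωpos 0 (e + 1)).le).trans
        (le_add_of_nonneg_right (mul_nonneg (hωpos 1 e).le (by positivity)))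
    by_cases h1 : j = 1 ∧ k = e
    · obtain ⟨rfl, rfl⟩ := h1
      exact (mul_le_mul_of_nonneg_left (hf1 t ht) (hωpos 1 k).le).trans
        (le_add_of_nonneg_left (mul_nonneg (hωpos 0 (k + 1)).le (by positivity)))
    · rw [interfaceForcing_eq_zero ε 0 Φ (X - Φ) h0 h1 t, abs_zero, mul_zero]
      exact hFω0
  -- L5a
  obtain ⟨c₁, hc₁, hmain⟩ := truncated_hop_estimate_anchored hΦ hX hτ hΦb hXb hg hb hS2 hq hprof hB hB' hF0 hfb
    hFω0 hfω
  -- the anchor coefficient from the anchor-site data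
  have hCB0 : 0 ≤ C * B := by
    have hB0 : 0 ≤ B := le_trans (mul_nonneg (hωpos 0 0).le (abs_nonneg _)) (hB 0 0)
    exact mul_nonneg hC0 hB0
  have hc₂ : |anchorCoeff ε τ Φ i₀ (truncFam e (X - Φ)) c₁| ≤ CaB := by
    unfold anchorCoeff
    rw [abs_div]
    have hΦa0 : 0 < |Φ i₀ 1 τ| := abs_pos.mpr hΦa
    have hnum : |truncFam e (X - Φ) i₀ 1 τ - c₁ * quadTermOn shiftSetFlat 0 (mirrorTable ε ε) Φ i₀ 1 τ|
        ≤ Rτ + C * B * Qa := by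
      have e1 : truncFam e (X - Φ) i₀ 1 τ = (X - Φ) i₀ 1 τ := by
        rw [truncFam_of_le (by omega)]
      rw [e1]
      refine (abs_sub _ _).trans (add_le_add hRτ ?_)
      rw [abs_mul]
      exact mul_le_mul hc₁ hQa (abs_nonneg _) hCB0
    have hRQ0 : 0 ≤ Rτ + C * B * Qa := (abs_nonneg _).trans hnum
    calc |truncFam e (X - Φ) i₀ 1 τ - c₁ * quadTermOn shiftSetFlat 0 (mirrorTable ε ε) Φ i₀ 1 τ| / |Φ i₀ 1 τ|
        ≤ (Rτ + C * B * Qa) / φa := div_le_div₀ hRQ0 hnum hφa hφale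
      _ ≤ CaB := hCaB2
  -- the landing at each core read-out site, and the anchor clause
  refine ⟨1 + anchorCoeff ε τ Φ i₀ (truncFam e (X - Φ)) c₁,
    c₁ / (1 + anchorCoeff ε τ Φ i₀ (truncFam e (X - Φ)) c₁), ?_, ?_, ?_, ?_, fun i k hk => ?_⟩
  · simpa using hc₂
  · exact (anchored_landing hΦ hg hb hMw hΦg (hc₁.trans hCaB1) hc₂ hCaB hmain i₀ 0
      (truncFam_sub_readout (show e ≤ 0 by omega) X Φ i₀ τ)).2.1
  · have := (abs_le.mp (hc₂.trans hCaB)).1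
    linarith
  · -- ANCHOR CLAUSE: the corrected deviation vanishes at the anchor site
    have hηX : truncFam e (X - Φ) i₀ (0 + 1) τ = X i₀ (0 + 1) τ - Φ i₀ (0 + 1) τ :=
      truncFam_sub_readout (show e ≤ 0 by omega) X Φ i₀ τ
    have h1 := anchored_landing_site (X := X) hΦ hg hb hMw hΦg (hc₁.trans hCaB1) hc₂ hCaB i₀ 0 hηX
    have h0 := anchorCoeff_spec (ε := ε) hΦa (truncFam e (X - Φ)) c₁
    simp only [zero_add] at h1
    rw [h0, abs_zero, mul_zero, zero_add] at h1
    exact h1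
  · have hηX : truncFam e (X - Φ) i (k + 1) τ = X i (k + 1) τ - Φ i (k + 1) τ := truncFam_sub_readout hk X Φ i τ
    exact (anchored_landing hΦ hg hb hMw hΦg (hc₁.trans hCaB1) hc₂ hCaB hmain i k hηX).2.2

end MirrorPulse

end Summit.NavierStokesRegularity.NavierStokesRegularity.Theorems

end
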